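import Summits.Ventures.Crystal3D.Bulk.GapPlanarity
import Summits.Ventures.Crystal3D.Bulk.GapCorners
import Summits.Ventures.Crystal3D.Bulk.GapTightHullEdges
import Summits.Ventures.Crystal3D.Bulk.GapHoleRow
import Summits.Ventures.Crystal3D.Bulk.GapNoHalfPlane
import Summits.Ventures.Crystal3D.Bulk.GapTightDegree
import Summits.Ventures.Crystal3D.Bulk.GapHemisphere
import Summits.Ventures.Crystal3D.Bulk.IntruderWitness
import Summits.Ventures.Crystal3D.Bulk.GapWindow
import HarnessLib

/-!
# The kernel rows of the GAP census, packaged: every reduced extremal configuration in the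
# window satisfies ALL of them, and GAP(h) follows from killing the configurations that do

HONEST FRAMING. Part of the venture `Summits/Ventures/Crystal3D` (cell `pub-crystal3d`, phase 2,
24-hour sprint `PLAN.md` R42/R43; seat typer-bulk-2). `Bulk/GapCensusSkeleton.lean` types the
census glue with an ABSTRACT completeness hypothesis `GapCensus.Complete h`. This file gives the
DECISION a CONCRETE replacement: the structure `CensusRows c` lists, as fields, every structural
row of the cell's `phase2/ENV-CENSUS/DESIGN-L12-THEORY.md` (validity table T1 / §P-L4) that is a
KERNEL THEOREM at a reduced extremal fourteen-ball configuration `c` with intruder distance in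
the census window `intruderDist c ≤ 1.26` —

* P-L1 no shift, relocation form (`Bulk/GapExtremal.lean`);
* P-L2(a) no closed tangent half-plane at shell balls and at the hole (`GapNoHalfPlane`,
  `GapIntruderStar`); P-L2(b),(c) degrees `∈ {0} ∪ [3,5]` at shell balls (intruder counted),
  `∈ [3,5]` at the intruder and `≤ 4` when `1.0515 ≤ D` (`GapTightDegree`, `GapDegrees(Sharp)`);
* P-L3(a) planarity: the tight graph is a Hales fan (`GapPlanarity`); T2 Lemma 16.1: tight pairs
  are exposed hull edges (`GapTightHullEdges`);
* rows R-min / R-tri: corner bounds `α₀`, `A_x(ρ)`, `A_p(ρ)` with equality on tight triangles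
  (`GapCorners`); row R-hole: no empty cap of radius `> ρ*` (`GapHoleRow`); E6: the shell lies in
  no closed hemisphere (`GapHemisphere`) —

and proves **`IsReducedExtremal.censusRows`** (every reduced extremal configuration with
`intruderDist c ≤ 1.26` satisfies `CensusRows c`) and the glue
**`gapTupleDiam_of_forall_censusRows`**: for `h ≤ 1.26`, if every configuration satisfying the
rows has intruder distance `≥ h`, then `GapTupleDiam h` (hence, with the kernel BIMODAL term,
`BulkCrystallization3D 702`, `bulkCrystallization3D_sharp_of_forall_censusRows`). What the
census must therefore supply is EXACTLY: no `c` with `CensusRows c` and `intruderDist c < h` —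
the remaining (unformalised) steps being the combinatorial enumeration of the plane maps these
rows allow (plantri class; faces P-L3(b)/Lemma L are NOT kernel theorems) and the per-cell kills.
Nothing is claimed about GAP(1.26).
-/

noncomputable section

open scoped BigOperators InnerProductSpace
open Finset Real

namespace Summit.Ventures.Crystal3D

open Literature.Geometry.DiscreteGeometry

variable {c : Fin 14 → EuclideanSpace ℝ (Fin 3)}

/-! ## The marked cell: the hole contacts are cut out by the level `D/2` of `⟪p, ·⟫` -/

/-- The intruder sits at `c 0 + D • p`, `p = gapDir c 13` its direction. -/
theorem IsGapConfig.eq_add_intruderDist_smul_gapDir (hc : IsGapConfig c) :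
    c 13 = c 0 + intruderDist c • gapDir c 13 := by
  rw [← sub_eq_iff_eq_add']
  exact hc.sub_eq_intruderDist_smul

/-- **The marked cell (SCORE-DESIGN §16 (c)).** A shell ball NOT touching the intruder has its
direction STRICTLY below the level `D/2` of the functional `⟪p, ·⟫` (`p = gapDir c 13`), while
the hole contacts are exactly at level `D/2` (`IsGapConfig.inner_gapDir_eq`): the hole contacts
are the vertex set of the face of `conv {shell directions}` exposed by `p`, i.e. (with `≥ 3`
contacts at an extremal configuration, `IsExtremal.three_le_card_intruderContacts`) ONE cell of
the spherical Delaunay subdivision of the shell with `p` its circumcentre and circumradius `ρ*`. -/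
theorem IsGapConfig.inner_gapDir_lt_of_not_touch (hc : IsGapConfig c) {j : Fin 14} (hj0 : j ≠ 0)
    (hj13 : j ≠ 13) (hnot : dist (c 13) (c j) ≠ 1) :
    ⟪gapDir c 13, gapDir c j⟫_ℝ < intruderDist c / 2 := by
  have h13 : (13 : Fin 14) ≠ 0 := by decide
  have hle := hc.inner_gapDir_le h13 hj0 (Ne.symm hj13)
  rw [tightLevel_of_left] at hle
  refine lt_of_le_of_ne hle fun heq => hnot ?_
  have hsq := hc.dist_sq_ray_shell (hc.norm_gapDir h13) (intruderDist c) hj0 hj13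
  rw [← hc.eq_add_intruderDist_smul_gapDir] at hsq
  rw [hc.gapDir_of_shell hj0 hj13] at heq
  rw [heq] at hsq
  have h1 : dist (c 13) (c j) ^ 2 = 1 := by rw [hsq]; ring
  have h0 : 0 ≤ dist (c 13) (c j) := dist_nonneg
  nlinarith [h1, h0]

/-- **The kernel rows of the GAP census** at a fourteen-ball configuration `c` (all PROVED at
every reduced extremal configuration with `intruderDist c ≤ 1.26`, `IsReducedExtremal.censusRows`).
Field by field: admissibility and `1 < D ≤ 1.26`; P-L1 (no shift, relocation form); P-L2(a) at
shell balls and at the hole; degrees; P-L3(a) fan; hull edges; corner rows R-min/R-tri; R-hole;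
E6. -/
structure CensusRows (c : Fin 14 → EuclideanSpace ℝ (Fin 3)) : Prop where
  /-- admissible: pairwise `≥ 1`, balls `1…12` touch ball `0` -/
  isGapConfig : IsGapConfig c
  /-- the intruder does not touch ball `0` -/
  one_lt_intruderDist : 1 < intruderDist c
  /-- the census window -/
  intruderDist_le : intruderDist c ≤ 1.26
  /-- P-L1 (no shift, relocation form): an admissible configuration intruding no further out
  has at least as many tight pairs -/
  tightCount_le : ∀ c', IsGapConfig c' → intruderDist c' ≤ intruderDist c →
    tightCount c ≤ tightCount c'
  /-- P-L2(a) at a shell ball with a tight partner: no closed tangent half-plane contains all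
  its tight partners -/
  exists_inner_pos_shell : ∀ i : Fin 14, i ≠ 0 → i ≠ 13 →
    (∃ j : Fin 14, j ≠ 0 ∧ j ≠ i ∧ dist (c i) (c j) = 1) →
    ∀ n : EuclideanSpace ℝ (Fin 3), n ≠ 0 → ⟪c i - c 0, n⟫_ℝ = 0 →
    ∃ j : Fin 14, j ≠ 0 ∧ j ≠ i ∧ dist (c i) (c j) = 1 ∧ 0 < ⟪n, c j - c 0⟫_ℝ
  /-- P-L2(a) at the hole: the hole contacts surround the hole direction -/
  exists_inner_pos_intruder : ∀ n : EuclideanSpace ℝ (Fin 3), n ≠ 0 → ⟪c 13 - c 0, n⟫_ℝ = 0 →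
    ∃ j : Fin 14, j ≠ 0 ∧ j ≠ 13 ∧ dist (c 13) (c j) = 1 ∧ 0 < ⟪n, c j - c 0⟫_ℝ
  /-- P-L2(b): a non-rattler shell ball has `≥ 3` tight partners (intruder counted) -/
  three_le_card_tight : ∀ i : Fin 14, i ≠ 0 → i ≠ 13 →
    (∃ j : Fin 14, j ≠ 0 ∧ j ≠ i ∧ dist (c i) (c j) = 1) →
    3 ≤ (univ.filter fun j : Fin 14 => j ≠ 0 ∧ j ≠ i ∧ dist (c i) (c j) = 1).card
  /-- P-L2(b): a shell ball has `≤ 5` tight partners (intruder counted) -/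
  card_tight_le_five : ∀ i : Fin 14, i ≠ 0 → i ≠ 13 →
    (univ.filter fun j : Fin 14 => j ≠ 0 ∧ j ≠ i ∧ dist (c i) (c j) = 1).card ≤ 5
  /-- P-L2(c): the intruder touches `≥ 3` shell balls -/
  three_le_card_intruderContacts :
    3 ≤ (univ.filter fun j : Fin 14 => j ≠ 0 ∧ j ≠ 13 ∧ dist (c 13) (c j) = 1).card
  /-- P-L2(c): the intruder touches `≤ 5` shell balls … -/
  card_intruderContacts_le_five :
    (univ.filter fun j : Fin 14 => j ≠ 0 ∧ j ≠ 13 ∧ dist (c 13) (c j) = 1).card ≤ 5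
  /-- … and `≤ 4` when `1.0515 ≤ D` (hole radius `≤ 58.28°`) -/
  card_intruderContacts_le_four : (1.0515 : ℝ) ≤ intruderDist c →
    (univ.filter fun j : Fin 14 => j ≠ 0 ∧ j ≠ 13 ∧ dist (c 13) (c j) = 1).card ≤ 4
  /-- P-L3(a): the two-level tight graph drawn on the thirteen directions is a fan (Hales) -/
  isFan : IsFan (tightVertices c) (tightGraph c)
  /-- T2 Lemma 16.1: every tight pair is an exposed edge of the hull of the directions -/
  exists_exposing_functional : ∀ i j : Fin 14, i ≠ 0 → j ≠ 0 → dist (c i) (c j) = 1 →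
    ∃ m : EuclideanSpace ℝ (Fin 3), ⟪m, gapDir c i⟫_ℝ = ⟪m, gapDir c j⟫_ℝ ∧
      ∀ k : Fin 14, k ≠ 0 → k ≠ i → k ≠ j → ⟪m, gapDir c k⟫_ℝ < ⟪m, gapDir c i⟫_ℝ
  /-- R-min at a shell ball between two shell contacts: corner `≥ α₀ = arccos (1/3)` -/
  arccos_third_le_corner : ∀ i j k : Fin 14, i ≠ 0 → i ≠ 13 → j ≠ 0 → j ≠ 13 → k ≠ 0 →
    k ≠ 13 → dist (c i) (c j) = 1 → dist (c i) (c k) = 1 → j ≠ k →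
    Real.arccos (1 / 3) ≤ corner c i j k
  /-- R-tri (x-triangle): corner `= α₀` -/
  corner_eq_arccos_third : ∀ i j k : Fin 14, i ≠ 0 → i ≠ 13 → j ≠ 0 → j ≠ 13 → k ≠ 0 →
    k ≠ 13 → dist (c i) (c j) = 1 → dist (c i) (c k) = 1 → dist (c j) (c k) = 1 →
    corner c i j k = Real.arccos (1 / 3)
  /-- R-min at a shell ball between a shell contact and the hole contact: corner `≥ A_x(ρ)` -/
  arccos_Ax_le_corner : ∀ i j : Fin 14, i ≠ 0 → i ≠ 13 → j ≠ 0 → j ≠ 13 →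
    dist (c i) (c j) = 1 → dist (c i) (c 13) = 1 →
    Real.arccos (intruderDist c / (√3 * √(4 - intruderDist c ^ 2))) ≤ corner c i j 13
  /-- R-tri (p-triangle, shell corner): corner `= A_x(ρ)` -/
  corner_eq_arccos_Ax : ∀ i j : Fin 14, i ≠ 0 → i ≠ 13 → j ≠ 0 → j ≠ 13 →
    dist (c i) (c j) = 1 → dist (c i) (c 13) = 1 → dist (c j) (c 13) = 1 →
    corner c i j 13 = Real.arccos (intruderDist c / (√3 * √(4 - intruderDist c ^ 2)))
  /-- R-min at the hole between two hole contacts: corner `≥ A_p(ρ)` -/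
  arccos_Ap_le_corner : ∀ j k : Fin 14, j ≠ 0 → j ≠ 13 → k ≠ 0 → k ≠ 13 →
    dist (c j) (c 13) = 1 → dist (c k) (c 13) = 1 → j ≠ k →
    Real.arccos ((2 - intruderDist c ^ 2) / (4 - intruderDist c ^ 2)) ≤ corner c 13 j k
  /-- R-tri (p-triangle, corner at the hole): corner `= A_p(ρ)` -/
  corner_eq_arccos_Ap : ∀ j k : Fin 14, j ≠ 0 → j ≠ 13 → k ≠ 0 → k ≠ 13 →
    dist (c j) (c 13) = 1 → dist (c k) (c 13) = 1 → dist (c j) (c k) = 1 →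
    corner c 13 j k = Real.arccos ((2 - intruderDist c ^ 2) / (4 - intruderDist c ^ 2))
  /-- marked cell: shell balls not touching the intruder are strictly below level `D/2` -/
  inner_gapDir_lt_of_not_touch : ∀ j : Fin 14, j ≠ 0 → j ≠ 13 → dist (c 13) (c j) ≠ 1 →
    ⟪gapDir c 13, gapDir c j⟫_ℝ < intruderDist c / 2
  /-- R-hole: every unit vector is within the hole radius of some shell direction -/
  exists_half_intruderDist_le_inner : ∀ q : EuclideanSpace ℝ (Fin 3), ‖q‖ = 1 →
    ∃ j : Fin 14, j ≠ 0 ∧ j ≠ 13 ∧ intruderDist c / 2 ≤ ⟪q, c j - c 0⟫_ℝ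
  /-- E6: the shell lies in no closed hemisphere -/
  exists_shell_inner_neg : ∀ v : EuclideanSpace ℝ (Fin 3), v ≠ 0 →
    ∃ j : Fin 14, j ≠ 0 ∧ j ≠ 13 ∧ ⟪v, c j - c 0⟫_ℝ < 0

/-- **Every reduced extremal configuration in the census window satisfies all the kernel rows.**
-/
theorem IsReducedExtremal.censusRows (hc : IsReducedExtremal c) (hD : intruderDist c ≤ 1.26) :
    CensusRows c := by
  have hg : IsGapConfig c := hc.1.1
  have hD1 : 1 < intruderDist c := hg.one_lt_intruderDist
  have hD2 : intruderDist c < 2 := by linarith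
  have hD3 : intruderDist c ^ 2 < 3 := by nlinarith
  have hD32 : intruderDist c < 3 / 2 := by linarith
  have hD127 : intruderDist c ^ 2 < 12 / 7 := by nlinarith
  exact
    { isGapConfig := hg
      one_lt_intruderDist := hD1
      intruderDist_le := hD
      tightCount_le := fun c' hc' hle => hc.tightCount_le hc' hle
      exists_inner_pos_shell := fun i hi0 hi13 ht n hn hnt => hc.exists_inner_pos hi0 hi13 ht hn hnt
      exists_inner_pos_intruder := fun n hn hnt => hc.1.exists_inner_pos_intruder hn hnt
      three_le_card_tight := fun i hi0 hi13 ht => hc.three_le_card_tight hi0 hi13 ht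
      card_tight_le_five := fun i hi0 hi13 => hg.card_tight_le_five hi0 hi13 hD127
      three_le_card_intruderContacts := hc.1.three_le_card_intruderContacts
      card_intruderContacts_le_five := hg.card_intruderContacts_le_five hD2
      card_intruderContacts_le_four := fun hlo => hg.card_intruderContacts_le_four_of_le hlo hD2
      isFan := hg.isFan_tightGraph hD3
      exists_exposing_functional := fun i j hi0 hj0 hij =>
        hg.exists_exposing_functional_of_tight hD32 hi0 hj0 hij
      arccos_third_le_corner := fun i j k hi0 hi13 hj0 hj13 hk0 hk13 hij hik hjk =>
        hg.arccos_third_le_corner hi0 hi13 hj0 hj13 hk0 hk13 hij hik hjk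
      corner_eq_arccos_third := fun i j k hi0 hi13 hj0 hj13 hk0 hk13 hij hik hjk =>
        hg.corner_eq_arccos_third hi0 hi13 hj0 hj13 hk0 hk13 hij hik hjk
      arccos_Ax_le_corner := fun i j hi0 hi13 hj0 hj13 hij hi =>
        hg.arccos_Ax_le_corner hD2 hi0 hi13 hj0 hj13 hij hi
      corner_eq_arccos_Ax := fun i j hi0 hi13 hj0 hj13 hij hi hj =>
        hg.corner_eq_arccos_Ax hD2 hi0 hi13 hj0 hj13 hij hi hj
      arccos_Ap_le_corner := fun j k hj0 hj13 hk0 hk13 hj hk hjk =>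
        hg.arccos_Ap_le_corner hD2 hj0 hj13 hk0 hk13 hj hk hjk
      corner_eq_arccos_Ap := fun j k hj0 hj13 hk0 hk13 hj hk hjk =>
        hg.corner_eq_arccos_Ap hD2 hj0 hj13 hk0 hk13 hj hk hjk
      inner_gapDir_lt_of_not_touch := fun j hj0 hj13 hnot =>
        hg.inner_gapDir_lt_of_not_touch hj0 hj13 hnot
      exists_half_intruderDist_le_inner := fun q hq => hc.1.exists_half_intruderDist_le_inner hq
      exists_shell_inner_neg := fun v hv => hg.exists_shell_inner_neg hv }

/-- **The census obligation in concrete form.** For `h ≤ 1.26`: if every configuration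
satisfying all the kernel rows has intruder distance `≥ h`, then `GapTupleDiam h`. (If GAP(h)
failed, a reduced extremal configuration with intruder distance `< h ≤ 1.26` would exist,
`not_gapTupleDiam_iff_exists_isReducedExtremal`, and it satisfies the rows.) -/
theorem gapTupleDiam_of_forall_censusRows {h : ℝ} (hh : h ≤ 1.26)
    (hkill : ∀ c : Fin 14 → EuclideanSpace ℝ (Fin 3), CensusRows c → h ≤ intruderDist c) :
    GapTupleDiam h := by
  by_contra hnot
  obtain ⟨c, hc, hlt⟩ := (not_gapTupleDiam_iff_exists_isReducedExtremal h).1 hnot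
  exact absurd (hkill c (hc.censusRows (by linarith))) (not_le.2 hlt)

/-- Equivalently: `GapTupleDiam h` (`h ≤ 1.26`) holds iff no configuration satisfying the
kernel rows intrudes below `h`. -/
theorem gapTupleDiam_iff_forall_censusRows {h : ℝ} (hh : h ≤ 1.26) :
    GapTupleDiam h ↔
      ∀ c : Fin 14 → EuclideanSpace ℝ (Fin 3), CensusRows c → h ≤ intruderDist c := by
  refine ⟨fun hg c hr => ?_, gapTupleDiam_of_forall_censusRows hh⟩
  exact (gapTupleDiam_iff_forall_isGapConfig h).1 hg c hr.isGapConfig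

/-- **End to end at `h* = 1.26`**: if no configuration satisfying the kernel rows has intruder
distance `< 1.26`, then — BIMODAL(1.26) being the kernel term
`kissingClassification_two_mul_hales_h0_holds` of `Bulk/BulkOfGapComputational.lean`, not
imported here to keep this file free of the computational axiom — `GapTupleDiam 1.26`, which
`Bulk/BulkOfGapComputational.lean`'s `bulkCrystallization3D_sharp_of_gapTupleDiam_hales_h0`
turns into `BulkCrystallization3D 702`. -/
theorem gapTupleDiam_126_of_forall_censusRows
    (hkill : ∀ c : Fin 14 → EuclideanSpace ℝ (Fin 3), CensusRows c → (1.26 : ℝ) ≤ intruderDist c) :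
    GapTupleDiam 1.26 :=
  gapTupleDiam_of_forall_censusRows le_rfl hkill

/-! ## The census socket of the DECISION chain in concrete form (window + cut) -/

/-- **Window version.** For `hi ≤ 1.26`: if no configuration satisfying the kernel rows has
intruder distance in `[lo, hi]`, then the window `[lo, hi]` is cleared
(`ExtremalFreeWindow lo hi` of `Bulk/GapWindow.lean`: no reduced extremal configuration there).
This is the referee-grade replacement for the abstract pair `S.CompleteReducedOn lo hi`,
`S.AllKilled`: ONE concrete statement about fourteen-ball configurations, no census structure
`S` to be named, no free `Realizes` predicate (cf. the vacuity watch of REF2-SPRINT §S9.1). -/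
theorem extremalFreeWindow_of_forall_censusRows {lo hi : ℝ} (hhi : hi ≤ 1.26)
    (hkill : ∀ c : Fin 14 → EuclideanSpace ℝ (Fin 3), CensusRows c →
      lo ≤ intruderDist c → intruderDist c ≤ hi → False) :
    ExtremalFreeWindow lo hi :=
  fun c hc h1 h2 => hkill c (hc.censusRows (h2.trans hhi)) h1 h2

/-- **CUT + concrete census ⇒ GAP(1.26).** A cut `NoHole t₁` (hole radius `< arccos t₁`; the
tree's kernel cut is `noHole_half`, the certified cuts of record are `NoHole 0.6` etc.) together
with: no configuration satisfying the kernel rows has intruder distance `≥ 2t₁` (the rows already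
confine it to `≤ 1.26`) — gives `NoHole 0.63` = GAP(1.26) in angular currency; compose with
`Bulk/BulkOfTammes.lean`'s `bulkCrystallization3D_sharp_of_noHole` for `BulkCrystallization3D 702`.
-/
theorem noHole_063_of_noHole_of_forall_censusRows {t₁ : ℝ} (h₁ : NoHole t₁)
    (hkill : ∀ c : Fin 14 → EuclideanSpace ℝ (Fin 3), CensusRows c →
      2 * t₁ ≤ intruderDist c → False) :
    NoHole 0.63 := by
  refine noHole_of_noHole_of_extremalFreeWindow (t := 0.63) (by norm_num) h₁ ?_
  rw [show (2 : ℝ) * 0.63 = 1.26 by norm_num]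
  exact extremalFreeWindow_of_forall_censusRows le_rfl fun c hc h1 _ => hkill c hc h1

/-- **At the frozen census bottom `t = 3/5`** (cap cut `NoHole 0.6` of record, TARGET-GAP
amendment (W)): `NoHole 0.6` and "no configuration satisfying the kernel rows has
`1.2 ≤ intruderDist`" give `NoHole 0.63`. -/
theorem noHole_063_of_noHole_06_of_forall_censusRows (h₁ : NoHole 0.6)
    (hkill : ∀ c : Fin 14 → EuclideanSpace ℝ (Fin 3), CensusRows c →
      (1.2 : ℝ) ≤ intruderDist c → False) :
    NoHole 0.63 :=
  noHole_063_of_noHole_of_forall_censusRows h₁ fun c hc h1 =>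
    hkill c hc (by rw [show (2 : ℝ) * 0.6 = 1.2 by norm_num] at h1; exact h1)

/-- **MT-free form at the kernel cut `60°`**: the tree's `noHole_half` (`NoHole (1/2)`, from the
kissing theorem) and "no configuration satisfying the kernel rows at all" (they all have
`1 < D ≤ 1.26`) give `NoHole 0.63` — the UNCONDITIONAL label of TARGET-GAP §4.2′ in concrete
form. -/
theorem noHole_063_of_forall_not_censusRows
    (hkill : ∀ c : Fin 14 → EuclideanSpace ℝ (Fin 3), ¬ CensusRows c) : NoHole 0.63 :=
  noHole_063_of_noHole_of_forall_censusRows noHole_half fun c hc _ => hkill c hc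

/-! ## Control: the Conjecture-H configuration (TARGET-GAP §4.6) is admissible and its tight
graph is a fan -/

/-- The exact fourteen-ball intruder configuration of `Bulk/IntruderWitness.lean` (the
Conjecture-H pair, hole radius `arccos (7√3/18) = 47.66°`) is admissible. -/
theorem Intruder.isGapConfig_pt : IsGapConfig Intruder.pt :=
  ⟨fun _ _ hij => Intruder.one_le_dist_pt hij, fun _ hi0 hi13 => Intruder.dist_pt_zero hi0 hi13⟩

/-- Its intruder distance is `7√3/9 = 1.3471…` (outside the census window, as it must be). -/
theorem Intruder.intruderDist_pt : intruderDist Intruder.pt = 7 * Real.sqrt 3 / 9 :=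
  Intruder.dist_pt_zero_thirteen

/-- **Non-vacuity control for the fan row**: the tight graph of the Conjecture-H configuration
(the mandatory control of the census machines, TARGET-GAP §4.6) is a fan — `intruderDist² =
49/27 < 3`. -/
theorem Intruder.isFan_tightGraph_pt : IsFan (tightVertices Intruder.pt) (tightGraph Intruder.pt) :=
  Intruder.isGapConfig_pt.isFan_tightGraph (by
    rw [Intruder.intruderDist_pt, Intruder.seven_sqrt_three_div_nine_sq]; norm_num)

/-! ## Appendix: the level-4 instance of the cut + census socket (lead 2026-08-22T23:02:58Z) -/

/-- **At level 4 of the cut ladder, `t = 0.6035`** (TARGET-GAP amendment (W7)): `NoHole 0.6035`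
and "no configuration satisfying the kernel rows has `1.207 ≤ intruderDist`" give
`NoHole 0.63` — the engines' obligation is literally «no fourteen-ball configuration `c` with
`CensusRows c` and `intruderDist c ∈ [1.207, 1.26]`». -/
theorem noHole_063_of_noHole_06035_of_forall_censusRows (h₁ : NoHole 0.6035)
    (hkill : ∀ c : Fin 14 → EuclideanSpace ℝ (Fin 3), CensusRows c →
      (1.207 : ℝ) ≤ intruderDist c → False) :
    NoHole 0.63 :=
  noHole_063_of_noHole_of_forall_censusRows h₁ fun c hc h1 =>
    hkill c hc (by rw [show (2 : ℝ) * 0.6035 = 1.207 by norm_num] at h1; exact h1)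

end Summit.Ventures.Crystal3D
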